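import Literature.Geometry.Lorentzian.CarterLayerTurningPoint
import Literature.Geometry.Lorentzian.CarterThresholdTurningPointTortoise
import HarnessLib

/-!
# Affine two-sided control of Carter's coefficient before the far turning point, tortoise variable,
# for a profile with fuzz `E`
(namespace `Literature.Geometry.Lorentzian.Kerr`.)

Generalisation of `CarterThresholdTurningPointTortoise.negCoeff_affine_bounds_tortoise_of_threshold`:
instead of the threshold `ω = mω₊` we assume the two-sided profile bounds
`Δ(J − E) ≤ (r² + a²)²(V − ω²) ≤ Δ(J + 3 + E)` (`E ≥ 0`) at every radius `r ≥ r₊ + ζ`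
(`CarterLayerRate` supplies them in the threshold sliver), and that the window starts beyond `r₊ + ζ`.
With `J(r_t) = 0` (`r_t − r₊ ≥ r₊ − r₋`), the true turning point `V(ρ b₂) = ω²` with
`ρ b₂ − r₊ ≥ r₊ − r₋`, `r_lo = ρ s_lo ≥ r₊ + ζ`, `r_b = ρ b₂`:

* `negCoeff_affine_bounds_tortoise_of_layer` — for `s ∈ [s_lo, b₂]`:
  `c₁(b₂ − s) − e₁ ≤ V(ρ s) − ω² ≤ c₂(b₂ − s) + e₂` with the threshold slopes
  `c₁ = 2ω²(r_lo + r₊)h(r_lo)Δ(r_lo)²/(r_b² + a²)³`, `c₂ = CΔ(r_b)²/(r_lo² + a²)³`,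
  `C = ω²(2(r_t + r₊) + (r_t + r₊)²/(r_lo − r₋))`, and the fuzzed offsets
  `e₁ = Δ(r_b)F₁/(r_lo² + a²)²`, `F₁ = 2(3 + E)(r_b + r₊)/(r_t + r₊) + 3 + 2E`,
  `e₂ = Δ(r_b)F₂/(r_lo² + a²)²`, `F₂ = C·E/(ω²(r_b + r₊)) + 3 + E`.

(`E = 0` recovers the threshold constants.) Input of the layer geometry of the one-barrier kernel
bound in the sliver case of the near-extremal Kerr programme (crux `KappaExplicitWaveDecay`).

## References
* M. Dafermos, I. Rodnianski, Y. Shlapentokh-Rothman, arXiv:1402.7034 = Ann. of Math. 183 (2016),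
  §§2.1.2, 6.3–6.5 (key `DafermosRodnianskiShlapentokhrothman2014`). The assembly is folklore.
-/

noncomputable section

open Set

namespace Literature.Geometry.Lorentzian

namespace Kerr

section LayerTortoise

variable {M a ω Λ : ℝ} {m : ℤ} {ρ : ℝ → ℝ}

set_option maxHeartbeats 400000 in
-- two halves with a long common preamble
/-- **Affine two-sided control before the far turning point, tortoise variable, with fuzz `E`.** See the
module docstring for the constants. [folklore] -/
theorem negCoeff_affine_bounds_tortoise_of_layer (hρ : IsTortoiseRadius M a ρ)
    (hMa : IsSubextremal M a) (hω : ω ≠ 0) {E ζ rt : ℝ} (hE : 0 ≤ E) (hζ : 0 < ζ)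
    (hrt : rPlus M a < rt) (hrtd : rPlus M a - rMinus M a ≤ rt - rPlus M a)
    (hJrt : Λ - 2 * a * m * ω - ω ^ 2 * (rt + rPlus M a) ^ 2 * ((rt - rPlus M a) / (rt - rMinus M a)) = 0)
    (hprof : ∀ r, rPlus M a + ζ ≤ r →
      delta M a r * (Λ - 2 * a * m * ω -
          ω ^ 2 * (r + rPlus M a) ^ 2 * ((r - rPlus M a) / (r - rMinus M a)) - E) ≤
        (r ^ 2 + a ^ 2) ^ 2 * (sepPotential M a ω m Λ r - ω ^ 2) ∧
      (r ^ 2 + a ^ 2) ^ 2 * (sepPotential M a ω m Λ r - ω ^ 2) ≤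
        delta M a r * (Λ - 2 * a * m * ω -
          ω ^ 2 * (r + rPlus M a) ^ 2 * ((r - rPlus M a) / (r - rMinus M a)) + 3 + E))
    {b₂ slo : ℝ} (hV : sepPotential M a ω m Λ (ρ b₂) = ω ^ 2)
    (hb₂d : rPlus M a - rMinus M a ≤ ρ b₂ - rPlus M a) (hslo : rPlus M a + ζ ≤ ρ slo)
    {s : ℝ} (hs : s ∈ Icc slo b₂) :
    2 * ω ^ 2 * (ρ slo + rPlus M a) * ((ρ slo - rPlus M a) / (ρ slo - rMinus M a)) *
          delta M a (ρ slo) ^ 2 / (ρ b₂ ^ 2 + a ^ 2) ^ 3 * (b₂ - s) -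
        delta M a (ρ b₂) * (2 * (3 + E) * (ρ b₂ + rPlus M a) / (rt + rPlus M a) + 3 + 2 * E) /
          (ρ slo ^ 2 + a ^ 2) ^ 2 ≤
      sepPotential M a ω m Λ (ρ s) - ω ^ 2 ∧
    sepPotential M a ω m Λ (ρ s) - ω ^ 2 ≤
      ω ^ 2 * (2 * (rt + rPlus M a) + (rt + rPlus M a) ^ 2 / (ρ slo - rMinus M a)) *
          delta M a (ρ b₂) ^ 2 / (ρ slo ^ 2 + a ^ 2) ^ 3 * (b₂ - s) +
        delta M a (ρ b₂) * (ω ^ 2 * (2 * (rt + rPlus M a) + (rt + rPlus M a) ^ 2 / (ρ slo - rMinus M a)) *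
          (E / (ω ^ 2 * (ρ b₂ + rPlus M a))) + 3 + E) / (ρ slo ^ 2 + a ^ 2) ^ 2 := by
  have ha : |a| < M := hMa
  have hM : 0 < M := hMa.pos
  have hrp : 0 < rPlus M a := rPlus_pos hM a
  have hd0 : 0 < rPlus M a - rMinus M a := sub_pos.2 hMa.rMinus_lt_rPlus
  -- radial vs tortoise distances on `[s, b₂]` (before abbreviating)
  have hdist₁ : delta M a (ρ s) / (ρ b₂ ^ 2 + a ^ 2) * (b₂ - s) ≤ ρ b₂ - ρ s := hρ.mul_sub_le_sub hMa hs.2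
  have hdist₂ : ρ b₂ - ρ s ≤ delta M a (ρ b₂) / (ρ s ^ 2 + a ^ 2) * (b₂ - s) := hρ.sub_le_mul_sub' hMa hs.2
  have hlor : ρ slo ≤ ρ s := (hρ.strictMono hMa).monotone hs.1
  have hrrb : ρ s ≤ ρ b₂ := (hρ.strictMono hMa).monotone hs.2
  set r := ρ s with hrdef
  set rlo := ρ slo with hrlo
  set rb := ρ b₂ with hrb
  clear_value r rlo rb
  have hrlop : rPlus M a < rlo := by linarith
  have hr : rPlus M a < r := by linarith
  have hrbp : rPlus M a < rb := by linarith
  have hr0 : 0 < r := hrp.trans hr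
  have hrlo0 : 0 < rlo := hrp.trans hrlop
  have hrb0 : 0 < rb := hrp.trans hrbp
  have hA : 0 < r ^ 2 + a ^ 2 := by positivity
  have hAlo : 0 < rlo ^ 2 + a ^ 2 := by positivity
  have hAb : 0 < rb ^ 2 + a ^ 2 := by positivity
  have hAlor : rlo ^ 2 + a ^ 2 ≤ r ^ 2 + a ^ 2 := by nlinarith only [hlor, hrlo0]
  have hArb : r ^ 2 + a ^ 2 ≤ rb ^ 2 + a ^ 2 := by nlinarith only [hrrb, hr0]
  have hΔr : 0 ≤ delta M a r := delta_nonneg ha.le hr.le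
  have hΔlo : 0 ≤ delta M a rlo := delta_nonneg ha.le hrlop.le
  have hΔb : 0 ≤ delta M a rb := delta_nonneg ha.le hrbp.le
  have hΔlor : delta M a rlo ≤ delta M a r := IsTortoiseRadius.delta_le_delta hMa hrlop.le hlor
  have hΔrb : delta M a r ≤ delta M a rb := IsTortoiseRadius.delta_le_delta hMa hr.le hrrb
  have hrm : 0 < r - rMinus M a := by linarith only [hMa.rMinus_lt_rPlus, hr]
  have hrlom : 0 < rlo - rMinus M a := by linarith only [hMa.rMinus_lt_rPlus, hrlop]
  have hω2 : 0 < ω ^ 2 := by positivity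
  have hrtp0 : 0 < rt + rPlus M a := by linarith only [hrt, hrp]
  have hrbp0 : 0 < rb + rPlus M a := by linarith only [hrbp, hrp]
  -- the radial affine bounds with fuzz
  obtain ⟨hlowb, hupb⟩ := hprof rb (by linarith)
  obtain ⟨hlowr, hupr⟩ := hprof r (by linarith)
  obtain ⟨hlow, hup⟩ := sq_mul_negCoeff_affine_bounds_of_layer (Λ := Λ) ha hω hE hrt hrtd hJrt hrbp hb₂d
    hV hlowb hupb hr hrrb hlowr hupr
  clear hlowb hupb hlowr hupr hprof
  have hbs : 0 ≤ b₂ - s := sub_nonneg.2 hs.2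
  -- `h(r) ≥ h(r_lo)`, both in `[0, 1]`
  have hh0 : 0 ≤ (rlo - rPlus M a) / (rlo - rMinus M a) :=
    div_nonneg (by linarith only [hrlop]) hrlom.le
  have hhr0 : 0 ≤ (r - rPlus M a) / (r - rMinus M a) := div_nonneg (by linarith only [hr]) hrm.le
  have hhmono : (rlo - rPlus M a) / (rlo - rMinus M a) ≤ (r - rPlus M a) / (r - rMinus M a) := by
    rw [div_le_div_iff₀ hrlom hrm]
    nlinarith [mul_nonneg (sub_nonneg.2 hlor) hd0.le]
  -- abbreviations
  set A := r ^ 2 + a ^ 2 with hAdef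
  set Alo := rlo ^ 2 + a ^ 2 with hAlodef
  set Ab := rb ^ 2 + a ^ 2 with hAbdef
  set k := 2 * ω ^ 2 * (r + rPlus M a) * ((r - rPlus M a) / (r - rMinus M a)) with hkdef
  set klo := 2 * ω ^ 2 * (rlo + rPlus M a) * ((rlo - rPlus M a) / (rlo - rMinus M a)) with hklodef
  set C := ω ^ 2 * (2 * (rt + rPlus M a) + (rt + rPlus M a) ^ 2 / (rlo - rMinus M a)) with hCdef
  set Cr := ω ^ 2 * (2 * (rt + rPlus M a) + (rt + rPlus M a) ^ 2 / (r - rMinus M a)) with hCrdef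
  set F₁ := 2 * (3 + E) * (rb + rPlus M a) / (rt + rPlus M a) + 3 + 2 * E with hF₁def
  set qv := sepPotential M a ω m Λ r - ω ^ 2 with hqv
  have hA2 : 0 < A ^ 2 := by positivity
  have hk0 : 0 ≤ k := mul_nonneg (mul_nonneg (by positivity) (by linarith only [hr0, hrp])) hhr0
  have hklo0 : 0 ≤ klo :=
    mul_nonneg (mul_nonneg (by positivity) (by linarith only [hrlo0, hrp])) hh0
  have hklok : klo ≤ k := by
    rw [hklodef, hkdef]
    have h1 : (rlo + rPlus M a) * ((rlo - rPlus M a) / (rlo - rMinus M a)) ≤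
        (r + rPlus M a) * ((r - rPlus M a) / (r - rMinus M a)) :=
      mul_le_mul (by linarith only [hlor]) hhmono hh0 (by linarith only [hr0, hrp])
    have h2 := mul_le_mul_of_nonneg_left h1 (by positivity : (0:ℝ) ≤ 2 * ω ^ 2)
    calc 2 * ω ^ 2 * (rlo + rPlus M a) * ((rlo - rPlus M a) / (rlo - rMinus M a))
        = 2 * ω ^ 2 * ((rlo + rPlus M a) * ((rlo - rPlus M a) / (rlo - rMinus M a))) := by ring
      _ ≤ 2 * ω ^ 2 * ((r + rPlus M a) * ((r - rPlus M a) / (r - rMinus M a))) := h2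
      _ = 2 * ω ^ 2 * (r + rPlus M a) * ((r - rPlus M a) / (r - rMinus M a)) := by ring
  have hF₁0 : 0 ≤ F₁ := by
    rw [hF₁def]
    have : 0 ≤ 2 * (3 + E) * (rb + rPlus M a) / (rt + rPlus M a) := by positivity
    linarith only [this, hE]
  have hC0 : 0 ≤ C :=
    mul_nonneg hω2.le (add_nonneg (by linarith only [hrtp0]) (div_nonneg (sq_nonneg _) hrlom.le))
  have hCr0 : 0 ≤ Cr :=
    mul_nonneg hω2.le (add_nonneg (by linarith only [hrtp0]) (div_nonneg (sq_nonneg _) hrm.le))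
  have hCrC : Cr ≤ C := by
    rw [hCrdef, hCdef]
    refine mul_le_mul_of_nonneg_left ?_ hω2.le
    have : (rt + rPlus M a) ^ 2 / (r - rMinus M a) ≤ (rt + rPlus M a) ^ 2 / (rlo - rMinus M a) :=
      div_le_div_of_nonneg_left (sq_nonneg _) hrlom (by linarith only [hlor])
    linarith only [this]
  set F₂ := C * (E / (ω ^ 2 * (rb + rPlus M a))) + 3 + E with hF₂def
  have hEω : 0 ≤ E / (ω ^ 2 * (rb + rPlus M a)) := by positivity
  have hF₂0 : 0 ≤ F₂ := by
    rw [hF₂def]; have := mul_nonneg hC0 hEω; linarith only [this, hE]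
  -- powers of the denominators compared
  have hA2b : A ^ 2 / Ab ^ 3 ≤ 1 / Ab := by
    rw [div_le_div_iff₀ (by positivity) hAb, one_mul]
    have : A ^ 2 ≤ Ab ^ 2 := pow_le_pow_left₀ hA.le hArb 2
    calc A ^ 2 * Ab ≤ Ab ^ 2 * Ab := mul_le_mul_of_nonneg_right this hAb.le
      _ = Ab ^ 3 := by ring
  have hA2lo : 1 ≤ A ^ 2 / Alo ^ 2 := by
    rw [one_le_div (by positivity)]; exact pow_le_pow_left₀ hAlo.le hAlor 2
  have hA3lo : 1 / A ≤ A ^ 2 / Alo ^ 3 := by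
    rw [div_le_div_iff₀ hA (by positivity), one_mul]
    calc Alo ^ 3 ≤ A ^ 3 := pow_le_pow_left₀ hAlo.le hAlor 3
      _ = A ^ 2 * A := by ring
  constructor
  · -- LOWER: `A²·qv ≥ Δ(r)(k(r_b − r) − F₁)`, `r_b − r ≥ X = Δ(b₂−s)/Ab`
    set X := delta M a r / Ab * (b₂ - s) with hXdef
    have hX0 : 0 ≤ X := mul_nonneg (div_nonneg hΔr hAb.le) hbs
    have hJlow : k * X - F₁ ≤ k * (rb - r) - F₁ := by
      have := mul_le_mul_of_nonneg_left hdist₁ hk0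
      linarith only [this]
    have hmain : delta M a r * (k * X - F₁) ≤ A ^ 2 * qv :=
      (mul_le_mul_of_nonneg_left hJlow hΔr).trans hlow
    -- `A²·c₁(b₂−s) ≤ Δ·k·X`
    have p1 : A ^ 2 * (klo * delta M a rlo ^ 2 / Ab ^ 3 * (b₂ - s)) ≤ delta M a r * (k * X) := by
      have e1 : A ^ 2 * (klo * delta M a rlo ^ 2 / Ab ^ 3 * (b₂ - s)) =
          klo * delta M a rlo ^ 2 * (b₂ - s) * (A ^ 2 / Ab ^ 3) := by ring
      have e2 : delta M a r * (k * X) = k * delta M a r ^ 2 * (b₂ - s) * (1 / Ab) := by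
        rw [hXdef]; ring
      rw [e1, e2]
      have f2 : klo * delta M a rlo ^ 2 * (b₂ - s) ≤ k * delta M a r ^ 2 * (b₂ - s) := by
        apply mul_le_mul_of_nonneg_right _ hbs
        exact mul_le_mul hklok (pow_le_pow_left₀ hΔlo hΔlor 2) (sq_nonneg _) hk0
      exact mul_le_mul f2 hA2b (by positivity) (by positivity)
    -- `Δ·F₁ ≤ A²·e₁`
    have p2 : delta M a r * F₁ ≤ A ^ 2 * (delta M a rb * F₁ / Alo ^ 2) := by
      have e2 : A ^ 2 * (delta M a rb * F₁ / Alo ^ 2) = delta M a rb * F₁ * (A ^ 2 / Alo ^ 2) := by ring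
      rw [e2]
      calc delta M a r * F₁ = delta M a r * F₁ * 1 := (mul_one _).symm
        _ ≤ delta M a rb * F₁ * (A ^ 2 / Alo ^ 2) :=
            mul_le_mul (mul_le_mul_of_nonneg_right hΔrb hF₁0) hA2lo zero_le_one (mul_nonneg hΔb hF₁0)
    have hfin : A ^ 2 * (klo * delta M a rlo ^ 2 / Ab ^ 3 * (b₂ - s) - delta M a rb * F₁ / Alo ^ 2) ≤
        A ^ 2 * qv := by
      have e : delta M a r * (k * X - F₁) = delta M a r * (k * X) - delta M a r * F₁ := by ring
      rw [e] at hmain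
      rw [mul_sub]
      linarith only [hmain, p1, p2]
    exact le_of_mul_le_mul_left hfin hA2
  · -- UPPER: `A²·qv ≤ Δ(r)(Cr(r_b − r) + Cr·E/(ω²(r_b+r₊)) + 3 + E)`, `r_b − r ≤ Y = Δb(b₂−s)/A`, `Cr ≤ C`
    set Y := delta M a rb / A * (b₂ - s) with hYdef
    have hY0 : 0 ≤ Y := mul_nonneg (div_nonneg hΔb hA.le) hbs
    have hJup : Cr * (rb - r) + (Cr * (E / (ω ^ 2 * (rb + rPlus M a))) + 3 + E) ≤ C * Y + F₂ := by
      have h1 := mul_le_mul hCrC hdist₂ (by linarith only [hrrb]) hC0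
      have h2 : Cr * (E / (ω ^ 2 * (rb + rPlus M a))) ≤ C * (E / (ω ^ 2 * (rb + rPlus M a))) :=
        mul_le_mul_of_nonneg_right hCrC hEω
      rw [hF₂def]; linarith only [h1, h2]
    have hmain : A ^ 2 * qv ≤ delta M a r * (C * Y + F₂) := hup.trans (mul_le_mul_of_nonneg_left hJup hΔr)
    -- `Δ·C·Y ≤ A²·c₂(b₂−s)`
    have q1 : delta M a r * (C * Y) ≤ A ^ 2 * (C * delta M a rb ^ 2 / Alo ^ 3 * (b₂ - s)) := by
      have e1 : delta M a r * (C * Y) = C * (delta M a r * delta M a rb) * (b₂ - s) * (1 / A) := by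
        rw [hYdef]; ring
      have e2 : A ^ 2 * (C * delta M a rb ^ 2 / Alo ^ 3 * (b₂ - s)) =
          C * (delta M a rb * delta M a rb) * (b₂ - s) * (A ^ 2 / Alo ^ 3) := by ring
      rw [e1, e2]
      have f1 : C * (delta M a r * delta M a rb) * (b₂ - s) ≤ C * (delta M a rb * delta M a rb) * (b₂ - s) := by
        apply mul_le_mul_of_nonneg_right _ hbs
        exact mul_le_mul_of_nonneg_left (mul_le_mul_of_nonneg_right hΔrb hΔb) hC0
      exact mul_le_mul f1 hA3lo (by positivity) (by positivity)
    -- `Δ F₂ ≤ A²·e₂`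
    have q2 : delta M a r * F₂ ≤ A ^ 2 * (delta M a rb * F₂ / Alo ^ 2) := by
      have e2 : A ^ 2 * (delta M a rb * F₂ / Alo ^ 2) = delta M a rb * F₂ * (A ^ 2 / Alo ^ 2) := by ring
      rw [e2]
      calc delta M a r * F₂ = delta M a r * F₂ * 1 := by ring
        _ ≤ delta M a rb * F₂ * (A ^ 2 / Alo ^ 2) :=
            mul_le_mul (mul_le_mul_of_nonneg_right hΔrb hF₂0) hA2lo zero_le_one (mul_nonneg hΔb hF₂0)
    have hfin : A ^ 2 * qv ≤ A ^ 2 * (C * delta M a rb ^ 2 / Alo ^ 3 * (b₂ - s) + delta M a rb * F₂ / Alo ^ 2) := by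
      rw [mul_add]
      have e : delta M a r * (C * Y + F₂) = delta M a r * (C * Y) + delta M a r * F₂ := by ring
      rw [e] at hmain
      linarith only [hmain, q1, q2]
    exact le_of_mul_le_mul_left hfin hA2

end LayerTortoise

end Kerr

end Literature.Geometry.Lorentzian

end
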